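import Summits.Ventures.HodgeRepro2.T6A3TheoremA

/-!
# T6-A3 — the pairing identity and Theorem A for an arbitrary Künneth map `κ`

Tier 6 (README §10), sub-goal A3, seat t6-p3; proof lane (carrier-free).  `T6A3Pairing` builds the
Künneth algebra map `κ : AA ι →ₐ[ℂ] H^*(B × B)` from the graded commutativity of a grading `ℬ` on
the target; the glue over the interface (`T6Interface` v0: `H^*(B × B, ℚ) = HB ᵍ⊗ HB` and its
complexification `TT_S`) has `κ` DIRECTLY (the base change of the graded tensor product) and no
grading on the target to hand.  This file restates Prop. A5.5, its non-vanishing corollary and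
Theorem A (TIER4 §A6) with `κ` as a hypothesis characterised by `κ (x ⊗ 1) = pr₁^* (Φ x)` and
`κ (1 ⊗ y) = pr₂^* (Φ y)` (`IsKunneth`); the proofs are those of `T6A3Pairing` / `T6A3TheoremA`
with `kunneth` replaced by `κ`.  Nothing here is a display.
-/

namespace Summit.Ventures.HodgeRepro2.T6.A3PairingKappa

open WeilPlanes WeilIntegral WeilDetect WeilCoproduct WeilPairing A3Pairing A3TheoremA BridgeDual

variable {ι : Type*} [DecidableEq ι] [Fintype ι]
variable {H : Type*} [Ring H] [Algebra ℂ H]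
variable {HH : Type*} [Ring HH] [Algebra ℂ HH]
variable {HS : Type*} [Ring HS] [Algebra ℂ HS]

section Kunneth

variable (Φ : A ι ≃ₐ[ℂ] H) (pr₁ pr₂ : H →ₐ[ℂ] HH) (κ : AA ι →ₐ[ℂ] HH)

/-- LOCAL HYPOTHESIS PREDICATE (not a display).  `κ : AA ι →ₐ[ℂ] H^*(B × B)` is a Künneth map for
the eigenbasis model `Φ`: `κ (x ⊗ 1) = pr₁^* (Φ x)` and `κ (1 ⊗ y) = pr₂^* (Φ y)` (the cross product
`a × b = pr₁^* a ∪ pr₂^* b`, Bredon VI.3 / Hatcher §3.2, transported through `Φ`). -/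
def IsKunneth : Prop :=
  (∀ x : A ι, κ (inl x) = pr₁ (Φ x)) ∧ (∀ y : A ι, κ (inr y) = pr₂ (Φ y))

variable {Φ pr₁ pr₂ κ}

omit [Fintype ι] in
/-- `κ (x ⊗ y) = pr₁^* (Φ x) ∪ pr₂^* (Φ y)`. -/
theorem kappa_tmul (hκ : IsKunneth Φ pr₁ pr₂ κ) (x y : A ι) :
    κ (x ᵍ⊗ₜ[ℂ] y) = pr₁ (Φ x) * pr₂ (Φ y) := by
  rw [← inl_mul_inr, map_mul, hκ.1, hκ.2]

omit [Fintype ι] in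
/-- `κ ∘ Δ = m^* ∘ Φ` (both algebra homomorphisms agree on `H^1`, by `CoproductDegreeOne`). -/
theorem kappa_comp_cop (hκ : IsKunneth Φ pr₁ pr₂ κ) (mStar : H →ₐ[ℂ] HH)
    (hcop : CoproductDegreeOne Φ pr₁ pr₂ mStar) : κ.comp cop = mStar.comp Φ.toAlgHom := by
  apply ExteriorAlgebra.hom_ext
  refine LinearMap.ext fun v => ?_
  simp only [LinearMap.comp_apply, AlgHom.toLinearMap_apply, AlgHom.comp_apply, cop_ι, map_add,
    hκ.1, hκ.2]
  exact (hcop v).symm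

omit [Fintype ι] in
/-- Pointwise form of `kappa_comp_cop`. -/
theorem kappa_cop (hκ : IsKunneth Φ pr₁ pr₂ κ) (mStar : H →ₐ[ℂ] HH)
    (hcop : CoproductDegreeOne Φ pr₁ pr₂ mStar) (x : A ι) : κ (cop x) = mStar (Φ x) := by
  have := congrArg (fun f => f x) (kappa_comp_cop hκ mStar hcop)
  simpa using this

/-- `∫_{B × B} ∘ κ = volB² · II` (Fubini (A5.2.0) transported to the model). -/
theorem intBB_kappa (hκ : IsKunneth Φ pr₁ pr₂ κ) (intB : H →ₗ[ℂ] ℂ) (intBB : HH →ₗ[ℂ] ℂ)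
    (volB : ℂ) (hF : FubiniProduct intB intBB pr₁ pr₂) (hvol : IntegralModel Φ intB volB)
    (X : AA ι) : intBB (κ X) = volB * volB * II X := by
  have key : intBB ∘ₗ κ.toLinearMap = (volB * volB) • (II : AA ι →ₗ[ℂ] ℂ) := by
    apply GradedTensorProduct.hom_ext
    apply TensorProduct.ext'
    intro x y
    simp only [LinearMap.comp_apply, LinearMap.smul_apply, LinearEquiv.coe_coe,
      AlgHom.toLinearMap_apply, smul_eq_mul]
    change intBB (κ (x ᵍ⊗ₜ[ℂ] y)) = volB * volB * II (x ᵍ⊗ₜ[ℂ] y)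
    rw [kappa_tmul hκ, hF, II_tmul, hvol.2, hvol.2]
    ring
  have := congrArg (fun f => f X) key
  simpa using this

end Kunneth

section Pairing

variable (Φ : A ι ≃ₐ[ℂ] H) (pr₁ pr₂ mStar : H →ₐ[ℂ] HH) (κ : AA ι →ₐ[ℂ] HH)
  (intB : H →ₗ[ℂ] ℂ) (intBB : HH →ₗ[ℂ] ℂ) (intS : HS →ₗ[ℂ] ℂ) (fStar : H →ₐ[ℂ] HS)
  (z y : H) (c : ι → ℂ) (volB : ℂ)

/-- **Proposition A5.5 (the pairing identity) for an arbitrary Künneth map `κ`:**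
`⟨y, θ^8 ∪ w_σ⟩ = volB · 8! · 4! · c_𝒫 · vol · ∫_S f^* w_σ` (exponents `(univ \ P₀).card` and
`P₀.card` for a general finite type of planes). -/
theorem pairing_identity_H_kappa (hκ : IsKunneth Φ pr₁ pr₂ κ)
    (hcop : CoproductDegreeOne Φ pr₁ pr₂ mStar) (hF : FubiniProduct intB intBB pr₁ pr₂)
    (hvol : IntegralModel Φ intB volB) (hy : PontryaginPairing Φ intB intBB pr₁ pr₂ mStar z y c)
    (hz : GysinPullback intB intS fStar z) (P₀ : Finset ι) (s : Bool) (hP₀ : P₀.card = 4) :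
    intB (y * Φ (theta c ^ (Finset.univ \ P₀).card * weil P₀ s)) =
      volB * (((Finset.univ \ P₀).card.factorial : ℂ) * (P₀.card.factorial : ℂ) * ∏ p, c p) *
        vol ι * intS (fStar (Φ (weil P₀ s))) := by
  have hκ1 : κ (inl (Φ.symm z) * inr (theta c ^ P₀.card) *
      cop (theta c ^ (Finset.univ \ P₀).card * weil P₀ s)) =
      pr₁ z * pr₂ (Φ (theta c) ^ 4) *
        mStar (Φ (theta c ^ (Finset.univ \ P₀).card * weil P₀ s)) := by
    rw [map_mul, map_mul, hκ.1, hκ.2, kappa_cop hκ mStar hcop, AlgEquiv.apply_symm_apply, map_pow,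
      hP₀]
  rw [hy, ← hκ1, intBB_kappa hκ intB intBB volB hF hvol, WeilVector.pairing_identity_weil]
  have step2 : volB * integral (Φ.symm z * weil P₀ s) = intS (fStar (Φ (weil P₀ s))) := by
    rw [← hvol.2, map_mul, AlgEquiv.apply_symm_apply, hz]
  calc volB * volB *
        ((((Finset.univ \ P₀).card.factorial : ℂ) * (P₀.card.factorial : ℂ) * ∏ p, c p) * vol ι *
          integral (Φ.symm z * weil P₀ s))
      = volB * (((Finset.univ \ P₀).card.factorial : ℂ) * (P₀.card.factorial : ℂ) * ∏ p, c p) *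
          vol ι * (volB * integral (Φ.symm z * weil P₀ s)) := by ring
    _ = _ := by rw [step2]

/-- **Where non-vanishing enters, for an arbitrary Künneth map `κ`:** a non-zero period of the
embedding `σ = (P₀, s)` makes `y` pair non-trivially with `θ^8 ∪ w_σ`. -/
theorem pair_ne_zero_of_period_ne_zero_kappa (hκ : IsKunneth Φ pr₁ pr₂ κ)
    (hcop : CoproductDegreeOne Φ pr₁ pr₂ mStar) (hF : FubiniProduct intB intBB pr₁ pr₂)
    (hvol : IntegralModel Φ intB volB) (hy : PontryaginPairing Φ intB intBB pr₁ pr₂ mStar z y c)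
    (hz : GysinPullback intB intS fStar z) (hc : ∀ p, c p ≠ 0) (P₀ : Finset ι) (s : Bool)
    (hP₀ : P₀.card = 4) (hN : intS (fStar (Φ (weil P₀ s))) ≠ 0) :
    intB (y * Φ (theta c ^ (Finset.univ \ P₀).card * weil P₀ s)) ≠ 0 := by
  rw [pairing_identity_H_kappa Φ pr₁ pr₂ mStar κ intB intBB intS fStar z y c volB hκ hcop hF hvol
    hy hz P₀ s hP₀]
  exact mul_ne_zero (pairing_constant_ne_zero c volB hvol.1 hc P₀) hN

end Pairing

section TheoremA

variable {R : Type*} [CommRing R]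
variable {V : Type*} [AddCommGroup V] [Module R V]
variable {V' : Type*} [AddCommGroup V'] [Module R V']
variable (Φ : A ι ≃ₐ[ℂ] H) (pr₁ pr₂ mStar : H →ₐ[ℂ] HH) (κ : AA ι →ₐ[ℂ] HH)
  (intB : H →ₗ[ℂ] ℂ) (intBB : HH →ₗ[ℂ] ℂ) (intS : HS →ₗ[ℂ] ℂ) (fStar : H →ₐ[ℂ] HS)
  (z : H) (c : ι → ℂ) (volB : ℂ)

/-- **Theorem A (TIER4 §A6) for an arbitrary Künneth map `κ`** — the hypotheses of
`T6A3TheoremA.weil_le_alg_of_periodInput` with `(ℬ, hGC, h₁, h₂)` replaced by `(κ, hκ)`. -/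
theorem weil_le_alg_of_periodInput_kappa (D : CohomBridgeData R V V') [IsSimpleModule R D.weil]
    (ιV : V → H) (yℚ : V) (hyalg : yℚ ∈ D.alg)
    (hcompat : ∀ w ∈ D.weil,
      ((D.pair yℚ (D.lefschetz w) : ℚ) : ℂ) = intB (ιV yℚ * (Φ (theta c) ^ 8 * ιV w)))
    (embeddings : Finset (Finset ι × Bool)) (hemb : ∀ σ ∈ embeddings, σ.1.card = 4)
    (hι : Fintype.card ι = 12)
    (hspan : ∀ σ ∈ embeddings, Φ (weil σ.1 σ.2) ∈ Submodule.span ℂ (ιV '' (D.weil : Set V)))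
    (hκ : IsKunneth Φ pr₁ pr₂ κ) (hcop : CoproductDegreeOne Φ pr₁ pr₂ mStar)
    (hF : FubiniProduct intB intBB pr₁ pr₂) (hvol : IntegralModel Φ intB volB)
    (hy : PontryaginPairing Φ intB intBB pr₁ pr₂ mStar z (ιV yℚ) c)
    (hz : GysinPullback intB intS fStar z) (hc : ∀ p, c p ≠ 0)
    (hN : ∃ σ ∈ embeddings, intS (periodForm Φ fStar σ) ≠ 0) :
    D.weil ≤ D.alg := by
  obtain ⟨σ, hσ, hNσ⟩ := hN
  rw [periodForm_eq] at hNσ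
  have hne := pair_ne_zero_of_period_ne_zero_kappa Φ pr₁ pr₂ mStar κ intB intBB intS fStar z
    (ιV yℚ) c volB hκ hcop hF hvol hy hz hc σ.1 σ.2 (hemb σ hσ) hNσ
  have h8 : (Finset.univ \ σ.1).card = 8 := by
    rw [Finset.card_sdiff_of_subset (Finset.subset_univ _), Finset.card_univ, hι, hemb σ hσ]
  rw [h8, map_mul Φ, map_pow Φ, ← mul_assoc] at hne
  obtain ⟨w, hw, hwne⟩ :=
    exists_mem_pair_ne_zero_of_mem_span intB (ιV yℚ * Φ (theta c) ^ 8) ιV D.weil (hspan σ hσ) hne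
  refine D.weil_le_alg_of_pair_lefschetz_ne_zero hyalg ⟨w, hw, ?_⟩
  intro h0
  apply hwne
  rw [mul_assoc, ← hcompat w hw, h0, Rat.cast_zero]

end TheoremA

end Summit.Ventures.HodgeRepro2.T6.A3PairingKappa
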